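import Summits.BirchSwinnertonDyer.BirchSwinnertonDyer.Theorems.CumulativeHeegnerLeopoldtCumulativeHeegnerInclusionAtThreeCumulativeClass
import Summits.BirchSwinnertonDyer.BirchSwinnertonDyer.Theorems.CyclotomicUntwistBallSystems
import Literature.NumberTheory.IwasawaTheory.PSCyclotomicLFunction
import HarnessLib

/-!
# Crux K1 `CumulativeHeegnerInclusionAtThree` (stmt-BirchSwinnertonDyer-24198) / child A 26896, line
# `birth` — from a tower of Heegner-type classes to a `Γ`-DISTRIBUTION in the tree's (Bellaïche /
# Mazur–Tate–Teitelbaum) currency `IsGammaDistribution` + `HasGrowthOrder`: the `α`-STABILISED system has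
# growth order `v_p(α)` (finite slope; `½` on the principal-series part of the wild cell), the CUMULATIVE
# (trace-zero, `a₃ = 0`) system has growth order exactly the CRITICAL value `1`

Width seat bsd-line-chl-k1-p1-w2 (`--supports stmt-BirchSwinnertonDyer-24198`). The route's TWO-LAYER PLAN
step (a) produces a family `κ♮_m` along the anticyclotomic tower and step (b) compares a coordinate of it
with `ℒ_𝔭` «at every finite-order character»; whether (b) can succeed is decided by the TEMPER (growth
order) of the ball-value system the family defines on `Γ = Gal(K_∞/K) ≅ ℤ_p`: for growth order `ν < 1` a
`Γ`-distribution is determined by its ball values / finite-order character values (Višik, Amice–Vélu;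
Bellaïche Thm. 6.2.13; in the tree: route CyclotomicUntwist's
`…Theorems.CyclotomicUntwistAmiceInjective.eq_zero_of_forall_gammaMahlerCoeff_eq_zero`), for `ν = 1` it is
not (`log(1+T)` kills every torsion point). This file computes that system and its growth ABSTRACTLY, in
the exact currency `Literature.NumberTheory.IwasawaTheory.IsGammaDistribution / HasGrowthOrder` of the
tree (D1 of route CyclotomicUntwist), so that both sub-lines of A can be read off:

Data (all hypotheses; no definition is introduced): a commutative coefficient ring `O` with `φ : O →+* ℂ_p`
(read `ℤ_p`, or `ℤ₃[ζ₃] ∋ α_g` for the untwist `g = f_E ⊗ η̄` of a principal-series curve); `O`-modules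
`A m` (read `E(K_m) ⊗ O`, `H¹(K_m, T)`) with the action `σ m` of the topological generator `γ` of `Γ`, the
restriction `res m : A m → A (m+1)` and the trace `tr m : A (m+1) → A m`, subject to
(E) `res ∘ σ = σ ∘ res`, (N) the NORM IDENTITY `Σ_{j mod p} (σ (m+1))^{p^m·j} x = res m (tr m x)`
(`Gal(K_{m+1}/K_m) = ⟨γ^{p^m}⟩`; restriction ∘ corestriction = norm), and `O`-semilinear functionals
`lam m : A m → ℂ_p` COMPATIBLE WITH RESTRICTION, `lam (m+1) ∘ res m = lam m` (read: a logarithm / Coleman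
coordinate at a prime above `𝔭`); a family `y m ∈ A m` with `tr m (y (m+1)) = a • y m` for a scalar
`a ∈ O` with `φ a ≠ 0`. The BALL SYSTEM of `y` is `μ n s := (φ a)⁻¹ ^ n · lam n ((σ n)^{s̃} (y n))`
(`s̃ = s.val`, the ball `γ^s Γ^{p^n}`).

* §1 `isGammaDistribution_ballSystem` — **`μ` IS a `Γ`-distribution** (additive over the fibres of
  `ℤ/p^{n+1} → ℤ/pⁿ`; the tree's `PSBallSystems.sum_filter_castHom_eq_sum_param` enumerates the fibre).
* §2 `hasGrowthOrder_ballSystem` — if `‖lam m x‖ ≤ B` (integral coordinate) and `‖φ a‖ = p^{−ν}` then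
  `μ` has growth order `ν`: the α-STABILISED Heegner system of a form with `U_p`-eigenvalue `a = α`,
  `v_p(α) = ν`. On the principal-series part of the wild cell (`TypeGNine`; untwist `g = f_E ⊗ η̄` of
  level `9M`, `a₃(g)·ā₃(g) = 3`, slope `ν = ½` — route CyclotomicUntwist, Theses ll. 15–25) this is the
  finite-slope regime `ν = ½ < 1`.
* §3 `isGammaDistribution_cumulative` / `hasGrowthOrder_one_cumulative` — for a TRACE-ZERO family
  (`tr m (y (m+1)) = 0`: `a₃(f_E) = 0` at the additive prime) the CUMULATIVE family `c` of
  `…CumulativeClass` (`c 0 = y 0`, `c (m+1) = res c m + y (m+1)`, hence `tr c (m+1) = p • c m`,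
  p617614) gives a `Γ`-distribution of growth order EXACTLY the critical value `1` (`a = p`, `‖φ p‖ = p⁻¹`):
  the quantitative form of the «order-1 uniqueness gap» of step (b) recorded on the line card.

HONEST FRAMING: pure algebra and one norm estimate; no Heegner point, Selmer group or `L`-function of the
tree is touched; the hypotheses (E), (N), compatibility of `lam` are exactly what an A-line must supply
from its objects. THEOREMS ONLY; no definition, no named fact, no `sorry`. BSD is not proved by any of this.

References: [Bellaiche2021] Def. 6.2.10, Thm. 6.2.13; [MazurTateTeitelbaum1986Invent] §I.10–I.11;
[PerrinRiou1987] §3; route-BirchSwinnertonDyer-CumulativeHeegnerLeopoldt TWO-LAYER PLAN (a)–(b);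
route-BirchSwinnertonDyer-CyclotomicUntwist (the untwist at a wild principal-series `3`).
-/

set_option autoImplicit false
-- `…BirchSwinnertonDyer.BirchSwinnertonDyer.Theorems…` is the problem's mandated namespace (D-0017).
set_option linter.dupNamespace false

noncomputable section

open scoped Classical

open Literature.NumberTheory.IwasawaTheory
  Summit.BirchSwinnertonDyer.BirchSwinnertonDyer.Theorems.PSBallSystems
  Summit.BirchSwinnertonDyer.BirchSwinnertonDyer.Theorems.CumulativeHeegnerInclusionAtThreeCumulativeClass

namespace Summit.BirchSwinnertonDyer.BirchSwinnertonDyer.Theorems.CumulativeHeegnerInclusionAtThreeGammaBallSystem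

variable {p : ℕ} [hp : Fact p.Prime]
variable {O : Type*} [CommRing O] (φ : O →+* ℂ_[p])
  {A : ℕ → Type*} [∀ m, AddCommGroup (A m)] [∀ m, Module O (A m)]
  (σ : ∀ m, A m →ₗ[O] A m) (res : ∀ m, A m →ₗ[O] A (m + 1)) (tr : ∀ m, A (m + 1) →ₗ[O] A m)
  (lam : ∀ m, A m →+ ℂ_[p])

/-! ### §0 Equivariance of iterates -/

/-- Restriction commutes with every power of `σ` once it commutes with `σ`. [folklore] -/
theorem res_comp_pow (hE : ∀ m (x : A m), res m (σ m x) = σ (m + 1) (res m x)) (m k : ℕ) (x : A m) :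
    res m (((σ m) ^ k) x) = ((σ (m + 1)) ^ k) (res m x) := by
  induction k generalizing x with
  | zero => simp
  | succ k ih => rw [pow_succ, Module.End.mul_apply, ih, hE, ← Module.End.mul_apply, ← pow_succ]

/-! ### §1 The ball system of a trace-compatible family is a `Γ`-distribution -/

/-- **The ball system `μ n s = (φ a)⁻ⁿ · λ_n(γ^s y_n)` of a family with `tr y_{m+1} = a • y_m` is a
`Γ`-distribution** (additivity over the fibres of `ℤ/p^{n+1} → ℤ/pⁿ`): by the norm identity (N) the fibre
sum is `(φa)^{-(n+1)} λ_{n+1}(γ^s · res(tr y_{n+1})) = (φa)^{-(n+1)} φ(a) λ_n(γ^s y_n)`.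
Hypotheses: (E) equivariance of `res`, (N) norm identity, `lam` restriction-compatible and
`O`-semilinear, `φ a ≠ 0`. [cite: MazurTateTeitelbaum1986Invent, §I.10–I.11] -/
theorem isGammaDistribution_ballSystem
    (hE : ∀ m (x : A m), res m (σ m x) = σ (m + 1) (res m x))
    (hN : ∀ m (x : A (m + 1)),
      ∑ j : ZMod (p ^ 1), ((σ (m + 1)) ^ (p ^ m * j.val)) x = res m (tr m x))
    (hlamres : ∀ m (x : A m), lam (m + 1) (res m x) = lam m x)
    (hlamsmul : ∀ m (b : O) (x : A m), lam m (b • x) = φ b * lam m x)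
    {a : O} (ha : φ a ≠ 0) {y : ∀ m, A m} (hy : ∀ m, tr m (y (m + 1)) = a • y m) :
    IsGammaDistribution p (fun n s ↦ (φ a)⁻¹ ^ n * lam n (((σ n) ^ s.val) (y n))) := by
  intro n s
  rw [sum_filter_castHom_eq_sum_param]
  -- each fibre point is `s̃ + pⁿ j̃`, whose `val` is literally that number
  have hval : ∀ j : ZMod (p ^ 1),
      (((s.val + p ^ n * j.val : ℕ) : ZMod (p ^ (n + 1)))).val = s.val + p ^ n * j.val :=
    fun j ↦ val_natCast_fibre s j
  simp_rw [hval, pow_add, Module.End.mul_apply]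
  -- `(φ a)⁻¹ ^ (n+1)` has been split as `(φ a)⁻¹ ^ n * (φ a)⁻¹ ^ 1` by `pow_add` as well
  rw [← Finset.mul_sum, ← map_sum, ← map_sum, hN n (y (n + 1)), hy n, map_smul, map_smul,
    ← res_comp_pow σ res hE n s.val, hlamsmul, hlamres, pow_one, mul_assoc, ← mul_assoc (φ a)⁻¹,
    inv_mul_cancel₀ ha, one_mul]

/-! ### §2 Growth order `v_p(a)`: the α-stabilised (finite-slope) case -/

/-- **Growth order of the ball system**: if the coordinate `lam` is INTEGRAL (`‖lam m x‖ ≤ B`) and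
`‖φ a‖ = p^{−ν}`, the system `μ n s = (φ a)⁻ⁿ λ_n(γ^s y_n)` has growth order `ν`
(`‖μ n s‖ ≤ B · p^{ν n}`). For the untwist `g` of a principal-series curve at the wild prime `3`
(`a = α_g`, `α_g ᾱ_g = 3`) this is `ν = ½ < 1`: the regime of Višik–Amice–Vélu uniqueness
(Bellaïche Thm. 6.2.13; tree `…CyclotomicUntwistAmiceInjective`). [cite: Bellaiche2021, Def. 6.2.10 and Thm. 6.2.13] -/
theorem hasGrowthOrder_ballSystem {a : O} {ν : ℝ} (hν : ‖φ a‖ = (p : ℝ) ^ (-ν))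
    {B : ℝ} (hB : ∀ m (x : A m), ‖lam m x‖ ≤ B) (y : ∀ m, A m) :
    HasGrowthOrder p ν (fun n s ↦ (φ a)⁻¹ ^ n * lam n (((σ n) ^ s.val) (y n))) := by
  have hp0 : (0 : ℝ) < p := by exact_mod_cast hp.out.pos
  refine ⟨B, fun n s ↦ ?_⟩
  rw [norm_mul, norm_pow, norm_inv, hν, ← Real.rpow_neg hp0.le, neg_neg, ← Real.rpow_mul_natCast hp0.le,
    mul_comm]
  exact mul_le_mul_of_nonneg_right (hB n _) (Real.rpow_nonneg hp0.le _)

/-- The two conclusions together for a trace-compatible family with integral coordinate: a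
`Γ`-distribution of growth order `ν = v_p(a)`. [cite: Bellaiche2021, Thm. 6.2.13] -/
theorem isGammaDistribution_and_hasGrowthOrder_ballSystem
    (hE : ∀ m (x : A m), res m (σ m x) = σ (m + 1) (res m x))
    (hN : ∀ m (x : A (m + 1)),
      ∑ j : ZMod (p ^ 1), ((σ (m + 1)) ^ (p ^ m * j.val)) x = res m (tr m x))
    (hlamres : ∀ m (x : A m), lam (m + 1) (res m x) = lam m x)
    (hlamsmul : ∀ m (b : O) (x : A m), lam m (b • x) = φ b * lam m x)
    {B : ℝ} (hB : ∀ m (x : A m), ‖lam m x‖ ≤ B)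
    {a : O} {ν : ℝ} (hν : ‖φ a‖ = (p : ℝ) ^ (-ν)) {y : ∀ m, A m} (hy : ∀ m, tr m (y (m + 1)) = a • y m) :
    IsGammaDistribution p (fun n s ↦ (φ a)⁻¹ ^ n * lam n (((σ n) ^ s.val) (y n))) ∧
      HasGrowthOrder p ν (fun n s ↦ (φ a)⁻¹ ^ n * lam n (((σ n) ^ s.val) (y n))) := by
  have ha : φ a ≠ 0 := by
    intro h0
    have h1 : ‖φ a‖ = 0 := by rw [h0, norm_zero]
    rw [hν] at h1
    exact (Real.rpow_pos_of_pos (by exact_mod_cast hp.out.pos) _).ne' h1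
  exact ⟨isGammaDistribution_ballSystem φ σ res tr lam hE hN hlamres hlamsmul ha hy,
    hasGrowthOrder_ballSystem φ σ lam hν hB y⟩

/-! ### §3 The cumulative (trace-zero) system: a `Γ`-distribution of the CRITICAL growth order `1` -/

/-- **The cumulative ball system is a `Γ`-distribution.** For a TRACE-ZERO family `y`
(`tr m (y (m+1)) = 0` — `a₃(f_E) = 0` at the additive prime) and its cumulative family `c`
(`c 0 = y 0`, `c (m+1) = res m (c m) + y (m+1)`; `tr (c (m+1)) = p • c m` by
`…CumulativeClass.tr_cumulative_succ`, p617614), the system `μ n s = (φ p)⁻ⁿ λ_n(γ^s c_n)` is additive.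
(The degree-`p` hypothesis `tr ∘ res = p` of the cumulative identity is a CONSEQUENCE of (E) + (N):
`res (tr (res x)) = Σ_j σ^{p^m j}(res x) = p • res x`; it is taken here in the form `htr` to match p617614.)
[cite: MazurTateTeitelbaum1986Invent, §I.10–I.11] -/
theorem isGammaDistribution_cumulative
    (hE : ∀ m (x : A m), res m (σ m x) = σ (m + 1) (res m x))
    (hN : ∀ m (x : A (m + 1)),
      ∑ j : ZMod (p ^ 1), ((σ (m + 1)) ^ (p ^ m * j.val)) x = res m (tr m x))
    (hlamres : ∀ m (x : A m), lam (m + 1) (res m x) = lam m x)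
    (hlamsmul : ∀ m (b : O) (x : A m), lam m (b • x) = φ b * lam m x)
    (htr : ∀ m (x : A m), tr m (res m x) = (p : O) • x) (hφp : φ (p : O) ≠ 0)
    {y c : ∀ m, A m} (hy : ∀ m, tr m (y (m + 1)) = 0)
    (hc : ∀ m, c (m + 1) = res m (c m) + y (m + 1)) :
    IsGammaDistribution p (fun n s ↦ (φ (p : O))⁻¹ ^ n * lam n (((σ n) ^ s.val) (c n))) :=
  isGammaDistribution_ballSystem φ σ res tr lam hE hN hlamres hlamsmul hφp
    (tr_cumulative_succ res tr (p : O) htr hy hc)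

/-- **The cumulative system has growth order exactly the critical value `1`** (never better from this
construction: one full power of `p` per layer, `…CumulativeClass.pow_smul_normalized`): with an integral
coordinate (`‖lam m x‖ ≤ B`) and `‖φ p‖ = p⁻¹` (the structure map of any `p`-adic coefficient ring),
`‖μ n s‖ ≤ B · pⁿ`. At `ν = 1` Višik–Amice–Vélu uniqueness FAILS (`log(1+T)` vanishes at every torsion
point), which is the «order-1 uniqueness gap» of step (b) for the trace-zero sub-line.
[cite: Bellaiche2021, Def. 6.2.10 and Thm. 6.2.13] -/
theorem hasGrowthOrder_one_cumulative (hφp : ‖φ (p : O)‖ = (p : ℝ)⁻¹)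
    {B : ℝ} (hB : ∀ m (x : A m), ‖lam m x‖ ≤ B) (c : ∀ m, A m) :
    HasGrowthOrder p 1 (fun n s ↦ (φ (p : O))⁻¹ ^ n * lam n (((σ n) ^ s.val) (c n))) := by
  refine hasGrowthOrder_ballSystem φ σ lam (a := (p : O)) (ν := 1) ?_ hB c
  rw [hφp, Real.rpow_neg_one]

end Summit.BirchSwinnertonDyer.BirchSwinnertonDyer.Theorems.CumulativeHeegnerInclusionAtThreeGammaBallSystem

end
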